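import Summits.BirchSwinnertonDyer.BirchSwinnertonDyer.Theorems.EisensteinPrimesBSDpOnCellCRetractionSpecializationHerbrand
import HarnessLib

/-!
# Crux 4 `BSDpOnCellC`, line «telescope» v4 — the registered stub `stub_herbrandTranslate` (K2-H), PROVED

Width seat `bsd-line-x2-p2` (gen 18) for the LEAD `cruxlead-19034` of crux 4 `BSDpOnCellC`
(stmt-BirchSwinnertonDyer-19034; `--supports`; file and theorem name per the LEAD's D-0169 format line 2026-08-29T15:29:25Z:
`Theorems/EisensteinPrimesBSDpOnCellCTelescopeHerbrandTranslate.lean`, `theorem stub_herbrandTranslate`). The stub text below is the REGISTERED signature of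
`Summit.BirchSwinnertonDyer.BirchSwinnertonDyer.Cruxes.BSDpOnCellC.Telescope.stub_herbrandTranslate` (skeleton
`Cruxes/BSDpOnCellC/Lines/telescope.lean` v4, LEAD cruxlead-19034 g1; binder-kind cure: the two `UniqueFactorizationMonoid`
hypotheses explicit) VERBATIM: the ONE-SIDED HERBRAND / EULER-CHARACTERISTIC SPECIALISATION of characteristic ideals
along a RETRACTION — for Noetherian factorial domains `A → B` with a ring retraction `φ : B →+* A` whose kernel is `(π)`
and a finite `B`-module `N` killed by some `s ∉ (π)`: `char_A(N/πN) ⊆ φ(char_B N)·A`.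

PROOF (pure commutative algebra, no named fact, no `sorry`): `RetractionSpecialization.charIdeal_quotSMulTop_le_map_of_retraction`
(`…RetractionSpecializationHerbrand.lean`), i.e. the TWO-SIDED Herbrand formula `char_A(N/πN) = char_A(N[π]) · φ(char_B N)`
for `π ≠ 0` (dévissage over a prime filtration: snake additivity of `ℓ_𝔮(·/π·) − ℓ_𝔮(·[π])`, cyclic modules `B/𝔭` by the
height bound `ht φ⁻¹𝔮 ≤ 2`; the generalisation of the tree's `PowerSeriesSpecialization.charIdeal_quotSMulTop_eq_mul`,
case `B = A⟦X⟧`) with the factor `char_A(N[π])` dropped, and transport of structure along the ring isomorphism `φ` when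
`π = 0`. In §K2 of the skeleton (`carrierAlg_of_witness`) it is applied with `A = R₀⟦T⟧`, `B = R₀⟦X⟧⟦T⟧`, `π = X − x_k`,
`φ =` coefficientwise evaluation `X ↦ x_k`.

HONEST FRAMING: this proves ONE registered stub (bench-grade commutative algebra) of the line; it does not prove the crux,
any other stub, or any summit statement; BSD is proved for no curve. THEOREMS ONLY.

## References

* N. Bourbaki, *Algèbre commutative*, Ch. VII §4.4–4.5. [BourbakiAC5to7]
* D. Delbourgo, *Elliptic Curves and Big Galois Representations* (2008), Lemma 10.5. [Delbourgo2008]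
* T. Ochiai, Compos. Math. 142 (2006), Lemma 7.2. [Ochiai2006]
* C. Skinner, E. Urban, Invent. Math. 195 (2014), Cor. 3.2.9. [SkinnerUrban2014]
-/

noncomputable section

-- D-0017: single-problem summit, the namespace repeats the problem name by design.
set_option linter.dupNamespace false
set_option autoImplicit false

namespace Summit.BirchSwinnertonDyer.BirchSwinnertonDyer.Theorems.TelescopeHerbrandTranslate

/-- **stub_herbrandTranslate** (crux 4 `BSDpOnCellC`, line «telescope» v4, K2-H; REGISTERED signature verbatim): the
one-sided Herbrand / Euler-characteristic specialisation of characteristic ideals along a retraction. Data: Noetherian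
factorial domains `A → B` (`Algebra A B`) with a ring retraction `φ : B →+* A` (`φ ∘ algebraMap = id`) whose kernel is
`(π)` (`φ π = 0`, `φ b = 0 → π ∣ b`); a finite `B`-module `N` (an `A`-module by `IsScalarTower`) killed by some
`s ∉ (π)`. Conclusion: `char_A(N/πN) ⊆ φ(char_B N)·A` (`charIdeal` = the tree's generic
`Literature.NumberTheory.EllipticCurves.Module.charIdeal`; `N/πN = QuotSMulTop π N`). Proof:
`RetractionSpecialization.charIdeal_quotSMulTop_le_map_of_retraction` (two-sided Herbrand formula for `π ≠ 0`,
transport of structure for `π = 0`). [folklore] -/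
theorem stub_herbrandTranslate :
    ∀ (A B : Type) [CommRing A] [CommRing B] [IsDomain A] [IsDomain B] [IsNoetherianRing A] [IsNoetherianRing B]
      [Algebra A B], UniqueFactorizationMonoid A → UniqueFactorizationMonoid B →
    ∀ (π : B) (φ : B →+* A),
      (∀ a : A, φ (algebraMap A B a) = a) → φ π = 0 → (∀ b : B, φ b = 0 → π ∣ b) →
    ∀ (N : Type) [AddCommGroup N] [Module B N] [Module A N] [IsScalarTower A B N] [Module.Finite B N],
      (∃ s : B, ¬ π ∣ s ∧ ∀ m : N, s • m = 0) →
      Literature.NumberTheory.EllipticCurves.Module.charIdeal A (QuotSMulTop π N) ≤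
        (Literature.NumberTheory.EllipticCurves.Module.charIdeal B N).map φ
    := by
  intro A B _ _ _ _ _ _ _ hufA hufB π φ hφ hφπ hker N _ _ _ _ _ hs
  haveI := hufA
  haveI := hufB
  exact RetractionSpecialization.charIdeal_quotSMulTop_le_map_of_retraction hφ hφπ hker N hs

end Summit.BirchSwinnertonDyer.BirchSwinnertonDyer.Theorems.TelescopeHerbrandTranslate

end
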